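import Mathlib
import Summits.NavierStokesRegularity.NavierStokesRegularity.Theorems.EulerZoomLiouvillePowerGaugeEulerLiouvilleHoopCylinderDensity
import HarnessLib

/-!
# R51 plate t54-CUT: THE SOLID CYLINDER AS A STACK OF DISCS, DISC ENERGY, CUT SELECTION
# (nsreg-p2 ROUND-51 «THE CAPS COME FOR FREE» §2, `NsregP2.R51.CutSelection`, text VERBATIM from `r51/Sketch51.lean` l.129–136 with
# `discEnergy V σ T₀ := ∫ z in closedBall (0 : E²) T₀, |DV(liftAt σ z)|_F²` UNFOLDED; seat ns-sfl-p1 g8,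
# `--supports stmt-NavierStokesRegularity-19832 --as helper`)

* `solidCyl_eq_preimage_planeEquiv` — `solidCyl s₁ s₂ T₀ = planeEquiv ⁻¹' ([s₁,s₂] × B̄_{T₀}(0))` (`planeEquiv : E³ ≃ᵐ ℝ × E²`, `y ↦ (y₂,(y₀,y₁))`,
  measure preserving, inverse `(σ,z) ↦ liftAt σ z`);
* `setIntegral_solidCyl_eq_setIntegral_slab` — `∫_{solidCyl} f = ∫_{(σ,z) ∈ [s₁,s₂] × B̄_{T₀}} f (liftAt σ z)` (no integrability needed),
  `integrableOn_solidCyl_iff_slab`;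
* `setIntegral_solidCyl_eq_integral_disc` — the DISC FUBINI `∫_{solidCyl s₁ s₂ T₀} f = ∫_{s₁}^{s₂} (∫_{B̄_{T₀}} f (liftAt σ z) dz) dσ` and
  `integrableOn_disc_integral` (the disc integrals are an integrable function of the height);
* `continuous_discEnergy` — `σ ↦ ∫_{B̄_{T₀}} |DV(liftAt σ z)|_F² dz` is continuous for `C¹ V`;
  `integral_discEnergy_eq` — `∫_a^{a+ℓ} discEnergy = ∫_{solidCyl a (a+ℓ) T₀} |DV|_F²`;
* ★ `cutSelection` — `NsregP2.R51.CutSelection` VERBATIM (`discEnergy` unfolded): every collar `[a, a+ℓ]` contains a height whose disc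
  energy is at most `ℓ⁻¹ ∫_{solidCyl a (a+ℓ) T₀} |DV|_F²` (first-moment method `MeasureTheory.exists_le_setAverage`).

HONEST FRAMING: measure-theoretic bookkeeping for the alt 8″ member of ROUND-51 (class-free; about an arbitrary `C¹` field); nothing
about the crux E (19832 OPEN) or NS regularity is proved here. [nsreg-p2 R51 §2; folklore]
-/

noncomputable section

set_option linter.dupNamespace false

open MeasureTheory Set Filter Topology Metric Function
open scoped RealInnerProductSpace Topology ENNReal

namespace Summit.NavierStokesRegularity.NavierStokesRegularity.Theorems.PowerGaugeEulerLiouville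

open Literature.Analysis Literature.Analysis.FluidPDE

namespace HoopCore

variable {F : Type*} [NormedAddCommGroup F] [NormedSpace ℝ F]

/-! ## The solid cylinder as a slab in the coordinates `(σ, z) ∈ ℝ × E²` -/

/-- `liftAt σ z` is the slicing map `Condenser.plane σ z` (both are `(z₀, z₁, σ)`). [folklore] -/
theorem liftAt_eq_plane (σ : ℝ) (z : EuclideanSpace ℝ (Fin 2)) : liftAt σ z = Condenser.plane σ z := rfl

/-- The inverse of `planeEquiv` is `(σ, z) ↦ liftAt σ z`. [folklore] -/
theorem planeEquiv_symm_apply_eq_liftAt (p : ℝ × EuclideanSpace ℝ (Fin 2)) :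
    Condenser.planeEquiv.symm p = liftAt p.1 p.2 := by
  rw [liftAt_eq_plane, ← Condenser.planeEquiv_symm_apply]

/-- The cylindrical radius of `liftAt σ z` is `‖z‖`. [folklore] -/
theorem cylRadius_liftAt (σ : ℝ) (z : EuclideanSpace ℝ (Fin 2)) : cylRadius (liftAt σ z) = ‖z‖ := by
  have h1 : cylRadius (liftAt σ z) ^ 2 = ‖z‖ ^ 2 := by
    rw [cylRadius_sq, EuclideanSpace.norm_sq_eq, Fin.sum_univ_two]
    simp only [Real.norm_eq_abs, sq_abs]
    rfl
  exact (sq_eq_sq₀ (cylRadius_nonneg _) (norm_nonneg _)).1 h1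

/-- The height of `liftAt σ z` is `σ`. [folklore] -/
theorem liftAt_apply_two (σ : ℝ) (z : EuclideanSpace ℝ (Fin 2)) : liftAt σ z 2 = σ := rfl

/-- **The solid cylinder is the preimage of the slab** `[s₁, s₂] × B̄_{T₀}(0)` under `planeEquiv : E³ ≃ᵐ ℝ × E²`. [folklore] -/
theorem solidCyl_eq_preimage_planeEquiv (s₁ s₂ T₀ : ℝ) :
    solidCyl s₁ s₂ T₀ = Condenser.planeEquiv ⁻¹' (Icc s₁ s₂ ×ˢ closedBall (0 : EuclideanSpace ℝ (Fin 2)) T₀) := by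
  ext y
  obtain ⟨p, rfl⟩ : ∃ p, Condenser.planeEquiv.symm p = y :=
    ⟨Condenser.planeEquiv y, Condenser.planeEquiv.symm_apply_apply y⟩
  rw [mem_preimage, Condenser.planeEquiv.apply_symm_apply, planeEquiv_symm_apply_eq_liftAt]
  simp only [solidCyl, mem_setOf_eq, mem_prod, mem_Icc, mem_closedBall, dist_zero_right, cylRadius_liftAt,
    liftAt_apply_two, and_assoc]

/-- **THE SLAB FORMULA** (no integrability needed): for every `f : E³ → F`,
`∫_{solidCyl s₁ s₂ T₀} f = ∫_{(σ,z) ∈ [s₁,s₂] × B̄_{T₀}(0)} f (liftAt σ z)`. [folklore] -/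
theorem setIntegral_solidCyl_eq_setIntegral_slab (f : EuclideanSpace ℝ (Fin 3) → F) (s₁ s₂ T₀ : ℝ) :
    ∫ y in solidCyl s₁ s₂ T₀, f y
      = ∫ p in Icc s₁ s₂ ×ˢ closedBall (0 : EuclideanSpace ℝ (Fin 2)) T₀, f (liftAt p.1 p.2) := by
  have h := Condenser.measurePreserving_planeEquiv.setIntegral_preimage_emb
    Condenser.planeEquiv.measurableEmbedding (fun p => f (liftAt p.1 p.2))
    (Icc s₁ s₂ ×ˢ closedBall (0 : EuclideanSpace ℝ (Fin 2)) T₀)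
  rw [← solidCyl_eq_preimage_planeEquiv] at h
  rw [← h]
  refine setIntegral_congr_fun (measurableSet_solidCyl s₁ s₂ T₀) fun y _ => ?_
  conv_lhs => rw [← Condenser.planeEquiv.symm_apply_apply y]
  rw [planeEquiv_symm_apply_eq_liftAt]

omit [NormedSpace ℝ F] in
/-- **Integrability on the solid cylinder** ⇔ integrability of `(σ, z) ↦ f (liftAt σ z)` on the slab `[s₁,s₂] × B̄_{T₀}(0)`.
[folklore] -/
theorem integrableOn_solidCyl_iff_slab (f : EuclideanSpace ℝ (Fin 3) → F) (s₁ s₂ T₀ : ℝ) :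
    IntegrableOn f (solidCyl s₁ s₂ T₀)
      ↔ IntegrableOn (fun p : ℝ × EuclideanSpace ℝ (Fin 2) => f (liftAt p.1 p.2))
          (Icc s₁ s₂ ×ˢ closedBall (0 : EuclideanSpace ℝ (Fin 2)) T₀) := by
  have h := Condenser.measurePreserving_planeEquiv.integrableOn_comp_preimage
    Condenser.planeEquiv.measurableEmbedding (f := fun p => f (liftAt p.1 p.2))
    (s := Icc s₁ s₂ ×ˢ closedBall (0 : EuclideanSpace ℝ (Fin 2)) T₀)
  rw [← solidCyl_eq_preimage_planeEquiv] at h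
  rw [← h]
  refine integrableOn_congr_fun (fun y _ => ?_) (measurableSet_solidCyl s₁ s₂ T₀)
  simp only [Function.comp_def]
  conv_lhs => rw [← Condenser.planeEquiv.symm_apply_apply y]
  rw [planeEquiv_symm_apply_eq_liftAt]

/-! ## Disc Fubini -/

/-- **THE DISC FUBINI FORMULA**: for `f` integrable on the solid cylinder and `s₁ ≤ s₂`,
`∫_{solidCyl s₁ s₂ T₀} f = ∫_{s₁}^{s₂} (∫_{B̄_{T₀}(0)} f (liftAt σ z) dz) dσ`. [folklore] -/
theorem setIntegral_solidCyl_eq_integral_disc (f : EuclideanSpace ℝ (Fin 3) → F) {s₁ s₂ T₀ : ℝ}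
    (hf : IntegrableOn f (solidCyl s₁ s₂ T₀)) (hs : s₁ ≤ s₂) :
    ∫ y in solidCyl s₁ s₂ T₀, f y
      = ∫ σ in s₁..s₂, ∫ z in closedBall (0 : EuclideanSpace ℝ (Fin 2)) T₀, f (liftAt σ z) := by
  have hI := (integrableOn_solidCyl_iff_slab f s₁ s₂ T₀).1 hf
  have h1 : ∫ p in Icc s₁ s₂ ×ˢ closedBall (0 : EuclideanSpace ℝ (Fin 2)) T₀, f (liftAt p.1 p.2)
      = ∫ σ in Icc s₁ s₂, ∫ z in closedBall (0 : EuclideanSpace ℝ (Fin 2)) T₀, f (liftAt σ z) :=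
    setIntegral_prod _ hI
  rw [setIntegral_solidCyl_eq_setIntegral_slab, h1, intervalIntegral.integral_of_le hs,
    setIntegral_congr_set (Ioc_ae_eq_Icc : Ioc s₁ s₂ =ᵐ[(volume : Measure ℝ)] Icc s₁ s₂)]

/-- The disc integrals `σ ↦ ∫_{B̄_{T₀}(0)} f (liftAt σ z) dz` of a function integrable on the solid cylinder form an integrable
function of the height on `[s₁, s₂]`. [folklore] -/
theorem integrableOn_disc_integral (f : EuclideanSpace ℝ (Fin 3) → F) {s₁ s₂ T₀ : ℝ}
    (hf : IntegrableOn f (solidCyl s₁ s₂ T₀)) :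
    IntegrableOn (fun σ => ∫ z in closedBall (0 : EuclideanSpace ℝ (Fin 2)) T₀, f (liftAt σ z)) (Icc s₁ s₂) := by
  have hI := (integrableOn_solidCyl_iff_slab f s₁ s₂ T₀).1 hf
  have hI' : Integrable (fun p : ℝ × EuclideanSpace ℝ (Fin 2) => f (liftAt p.1 p.2))
      ((volume.restrict (Icc s₁ s₂)).prod (volume.restrict (closedBall (0 : EuclideanSpace ℝ (Fin 2)) T₀))) := by
    rw [Measure.prod_restrict]
    exact hI
  exact hI'.integral_prod_left

/-! ## Disc energy -/

/-- The Frobenius energy density `y ↦ |DV(y)|_F²` of a `C¹` field is continuous (private copy of the lemma of the same name in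
`…HoopRunTools`, to keep this bookkeeping file's imports light). [folklore] -/
private theorem continuous_frobeniusSq_fderiv_aux {V : EuclideanSpace ℝ (Fin 3) → EuclideanSpace ℝ (Fin 3)} (hV : ContDiff ℝ 1 V) :
    Continuous fun y => frobeniusNormSq (fderiv ℝ V y) := by
  unfold frobeniusNormSq
  exact continuous_finsetSum _ fun i _ => (((hV.continuous_fderiv one_ne_zero).clm_apply continuous_const).norm).pow 2

/-- `(σ, z) ↦ liftAt σ z` is continuous. [folklore] -/
theorem continuous_liftAt_uncurry : Continuous fun p : ℝ × EuclideanSpace ℝ (Fin 2) => liftAt p.1 p.2 := by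
  have h : (fun p : ℝ × EuclideanSpace ℝ (Fin 2) => liftAt p.1 p.2) = fun p => Condenser.planeEquiv.symm p := by
    funext p; rw [planeEquiv_symm_apply_eq_liftAt]
  rw [h]
  refine (PiLp.continuous_toLp 2 _).comp ?_
  refine continuous_pi fun i => ?_
  fin_cases i
  · exact (PiLp.continuous_apply 2 _ 0).comp continuous_snd
  · exact (PiLp.continuous_apply 2 _ 1).comp continuous_snd
  · exact continuous_fst

/-- **The disc energy is continuous in the height**: for `C¹ V`, `σ ↦ ∫_{B̄_{T₀}(0)} |DV(liftAt σ z)|_F² dz` is continuous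
(a continuous integrand on a compact disc). [folklore] -/
theorem continuous_discEnergy {V : EuclideanSpace ℝ (Fin 3) → EuclideanSpace ℝ (Fin 3)} (hV : ContDiff ℝ 1 V) (T₀ : ℝ) :
    Continuous fun σ : ℝ => ∫ z in closedBall (0 : EuclideanSpace ℝ (Fin 2)) T₀, frobeniusNormSq (fderiv ℝ V (liftAt σ z)) :=
  continuous_parametric_integral_of_continuous
    (f := fun (σ : ℝ) (z : EuclideanSpace ℝ (Fin 2)) => frobeniusNormSq (fderiv ℝ V (liftAt σ z)))
    ((continuous_frobeniusSq_fderiv_aux hV).comp continuous_liftAt_uncurry)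
    (isCompact_closedBall (0 : EuclideanSpace ℝ (Fin 2)) T₀)

/-- **The collar integral of the disc energy is the tube energy**: for `C¹ V` and `s₁ ≤ s₂`,
`∫_{s₁}^{s₂} (∫_{B̄_{T₀}(0)} |DV(liftAt σ z)|_F² dz) dσ = ∫_{solidCyl s₁ s₂ T₀} |DV|_F²`. [folklore] -/
theorem integral_discEnergy_eq {V : EuclideanSpace ℝ (Fin 3) → EuclideanSpace ℝ (Fin 3)} (hV : ContDiff ℝ 1 V)
    {s₁ s₂ : ℝ} (hs : s₁ ≤ s₂) (T₀ : ℝ) :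
    ∫ σ in s₁..s₂, ∫ z in closedBall (0 : EuclideanSpace ℝ (Fin 2)) T₀, frobeniusNormSq (fderiv ℝ V (liftAt σ z))
      = ∫ y in solidCyl s₁ s₂ T₀, frobeniusNormSq (fderiv ℝ V y) :=
  (setIntegral_solidCyl_eq_integral_disc _ (integrableOn_frobeniusNormSq_fderiv_solidCyl hV s₁ s₂ T₀) hs).symm

/-! ## Cut selection -/

/-- **CUT SELECTION** (`NsregP2.R51.CutSelection` VERBATIM, nsreg-p2 ROUND-51 §2, with `discEnergy V σ T₀ =
∫ z in closedBall (0 : E²) T₀, |DV(liftAt σ z)|_F²` unfolded): for `C¹ V`, `ℓ > 0`, `T₀ > 0`, every collar `[a, a + ℓ]` contains a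
height `σ` whose disc energy is at most the collar average `ℓ⁻¹ ∫_{solidCyl a (a+ℓ) T₀} |DV|_F²` (disc Fubini + the first-moment method
`MeasureTheory.exists_le_setAverage`). [nsreg-p2 R51 §2; folklore] -/
theorem cutSelection :
    ∀ (V : EuclideanSpace ℝ (Fin 3) → EuclideanSpace ℝ (Fin 3)) (a ℓ T₀ : ℝ), 0 < ℓ → 0 < T₀ → ContDiff ℝ 1 V →
      ∃ σ ∈ Icc a (a + ℓ),
        (∫ z in closedBall (0 : EuclideanSpace ℝ (Fin 2)) T₀, frobeniusNormSq (fderiv ℝ V (HoopCore.liftAt σ z)))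
          ≤ (1 / ℓ) * ∫ y in HoopCore.solidCyl a (a + ℓ) T₀, frobeniusNormSq (fderiv ℝ V y) := by
  intro V a ℓ T₀ hℓ _hT₀ hV
  have haℓ : a ≤ a + ℓ := by linarith
  have hint := integrableOn_disc_integral (fun y => frobeniusNormSq (fderiv ℝ V y))
    (integrableOn_frobeniusNormSq_fderiv_solidCyl hV a (a + ℓ) T₀)
  have hvol : volume (Icc a (a + ℓ)) = ENNReal.ofReal ℓ := by
    rw [Real.volume_Icc, add_sub_cancel_left]
  have hμ : volume (Icc a (a + ℓ)) ≠ 0 := by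
    rw [hvol]; exact (ENNReal.ofReal_pos.2 hℓ).ne'
  have hμ' : volume (Icc a (a + ℓ)) ≠ ∞ := by
    rw [hvol]; exact ENNReal.ofReal_ne_top
  obtain ⟨σ, hσ, hle⟩ := exists_le_setAverage hμ hμ' hint
  refine ⟨σ, hσ, hle.trans_eq ?_⟩
  rw [setAverage_eq, measureReal_def, hvol, ENNReal.toReal_ofReal hℓ.le, smul_eq_mul, one_div,
    ← integral_discEnergy_eq hV haℓ T₀, intervalIntegral.integral_of_le haℓ,
    setIntegral_congr_set (Ioc_ae_eq_Icc : Ioc a (a + ℓ) =ᵐ[(volume : Measure ℝ)] Icc a (a + ℓ))]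

end HoopCore

end Summit.NavierStokesRegularity.NavierStokesRegularity.Theorems.PowerGaugeEulerLiouville

end
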